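import Summits.QuantumFields.YangMills.Theses.TransportFieldFano
import Summits.QuantumFields.YangMills.Theorems.AdjointLoopFanoDirichletKinematic
import Summits.QuantumFields.YangMills.Theorems.FemtoTransferGapSlabRayleigh
import HarnessLib

/-!
# `TransportFieldFano.UncertaintyDoor` (item stmt-QuantumFields-23356) — PROVED:
# CoherentToronFloor → MeanLoopCeilingWeak → TransportKineticCeiling → RobertsonInequality → the ∃-window Fano floor

Route `TransportFieldFano` (D-0145 LINE g17-A of seat ym-idea-4).  Pure real arithmetic: with `E = E[XF]`, `K = ‖XΩ‖² ≥ 0`, `V = Var_Ω(F)`,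
`m = E_Ω[F] ≥ 0` (`F ≥ 0`), the floor `|E| ≥ cL^{−k₁}β^{−2/3}`, the two ceilings `m ≤ C₂L^{k₂}β^{−1/2}`, `K ≤ C₃L^{k₃}β^{1/8}` and Robertson
`E² ≤ 4KV` give `K, V > 0` and `V ≥ c²L^{−2k₁}β^{−4/3}/(4C₃L^{k₃}β^{1/8})`; at `q = 47/48` the comparison `Mβ^{−q}m ≤ V` reduces to
`4MC₂C₃·L^{2k₁+k₂+k₃} ≤ c²β^{1/48}`, true on `L ≤ β^a` with `a = min(a₁,a₂,a₃,1/4,1/(96(K+1)))`, `K = max(2k₁+k₂+k₃,0)`, for `β ≥ β₀(M)`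
(`isolated as `uncertainty_arith`).

HONEST FRAMING: bookkeeping; the three cruxes and the Robertson support are OPEN hypotheses here; K2a, R2ξ″ and the YM mass gap are NOT proved.
No `sorry`, no new axiom, no new definition.  References: [cite: ReedSimonIV1978, Thm. XIII.1].
-/

set_option autoImplicit false

noncomputable section

open MeasureTheory Filter Topology Real
open Literature.MathematicalPhysics.QuantumFieldTheory (GaugeConfig Site gaugeTransform)

namespace Summit.QuantumFields.YangMills.Theorems.TransportFieldFano

open Summit.QuantumFields.YangMills.Theorems.FemtoTransferGap
open Summit.QuantumFields.YangMills.Theorems.AdjointLoopFano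

/-! ## §1 The arithmetic core -/

/-- **Uncertainty arithmetic** (`q = 47/48`): floor + two ceilings + Robertson ⇒ `Mβ^{−q}m ≤ V` and `0 < V`, on `1 ≤ L ≤ β^a` with
`aK ≤ 1/96`, `2k₁+k₂+k₃ ≤ K`, `0 ≤ K`, once `4MC₂C₃ ≤ c²β^{1/96}` (all constants non-negative, `c > 0`, `β ≥ 1`). [cite: ReedSimonIV1978, Thm. XIII.1] -/
theorem uncertainty_arith {E Kx V m c C₂ C₃ M β Lr k₁ k₂ k₃ K a : ℝ} (hc : 0 < c) (hβ : 1 ≤ β) (hL : 1 ≤ Lr)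
    (hLa : Lr ≤ β ^ a) (haK : a * K ≤ 1 / 96) (hK : 2 * k₁ + k₂ + k₃ ≤ K) (hK0 : 0 ≤ K)
    (hKx0 : 0 ≤ Kx) (hC₂ : 0 ≤ C₂) (hC₃ : 0 ≤ C₃) (hM : 0 ≤ M)
    (hfloor : c * Lr ^ (-k₁) * β ^ (-(2 : ℝ) / 3) ≤ |E|) (hmean : m ≤ C₂ * Lr ^ k₂ * β ^ (-(1 : ℝ) / 2))
    (hkin : Kx ≤ C₃ * Lr ^ k₃ * β ^ ((1 : ℝ) / 8)) (hRob : E ^ 2 ≤ 4 * Kx * V)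
    (hbig : 4 * M * C₂ * C₃ ≤ c ^ 2 * β ^ ((1 : ℝ) / 96)) :
    M * β ^ (-(47 / 48 : ℝ)) * m ≤ V ∧ 0 < V := by
  rw [show (-(47 / 48 : ℝ)) = -(47 : ℝ) / 48 by norm_num]
  have hβ0 : 0 < β := by linarith
  have hL0 : 0 < Lr := by linarith
  -- the floor squared
  set ℓ : ℝ := Lr ^ (-k₁) with hℓ
  set b : ℝ := β ^ (-(2 : ℝ) / 3) with hb
  have hℓ0 : 0 < ℓ := Real.rpow_pos_of_pos hL0 _
  have hb0 : 0 < b := Real.rpow_pos_of_pos hβ0 _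
  have he0 : 0 < c * ℓ * b := by positivity
  have hE2 : (c * ℓ * b) ^ 2 ≤ E ^ 2 := by
    have h := pow_le_pow_left₀ he0.le hfloor 2
    rwa [sq_abs] at h
  -- `V > 0`, `Kx > 0`
  have hV : 0 < V := by
    by_contra hV
    have hV' : V ≤ 0 := not_lt.mp hV
    have : 4 * Kx * V ≤ 0 := by nlinarith
    nlinarith [pow_pos he0 2]
  have hKx : 0 < Kx := by
    rcases hKx0.lt_or_eq with h | h
    · exact h
    · rw [← h] at hRob; nlinarith [pow_pos he0 2]
  -- `κ = C₃ L^{k₃} β^{1/8} ≥ Kx > 0` and `e₀² ≤ 4κV`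
  set κ : ℝ := C₃ * Lr ^ k₃ * β ^ ((1 : ℝ) / 8) with hκ
  have hκ0 : 0 < κ := hKx.trans_le hkin
  have h4κV : (c * ℓ * b) ^ 2 ≤ V * (4 * κ) := by
    have : 4 * Kx * V ≤ 4 * κ * V := by nlinarith
    linarith
  refine ⟨?_, hV⟩
  -- reduce to `R · 4κ ≤ e₀²`
  have hq0 : 0 ≤ β ^ (-(47 : ℝ) / 48) := Real.rpow_nonneg hβ0.le _
  have hR : M * β ^ (-(47 : ℝ) / 48) * m ≤ M * β ^ (-(47 : ℝ) / 48) * (C₂ * Lr ^ k₂ * β ^ (-(1 : ℝ) / 2)) :=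
    mul_le_mul_of_nonneg_left hmean (mul_nonneg hM hq0)
  refine hR.trans (le_of_mul_le_mul_right (a := 4 * κ) ?_ (by positivity))
  refine le_trans ?_ h4κV
  -- exponent bookkeeping
  have hβsplit : β ^ (-(47 : ℝ) / 48) * β ^ (-(1 : ℝ) / 2) * β ^ ((1 : ℝ) / 8) = b * b * β ^ (-(1 : ℝ) / 48) := by
    rw [hb, ← Real.rpow_add hβ0, ← Real.rpow_add hβ0, ← Real.rpow_add hβ0, ← Real.rpow_add hβ0]; norm_num
  have hLk₁ : Lr ^ k₁ * ℓ = 1 := by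
    rw [hℓ, Real.rpow_neg hL0.le, mul_inv_cancel₀ (Real.rpow_pos_of_pos hL0 _).ne']
  have hP : Lr ^ k₂ * Lr ^ k₃ * Lr ^ k₁ * Lr ^ k₁ = Lr ^ (k₂ + k₃ + k₁ + k₁) := by
    rw [Real.rpow_add hL0, Real.rpow_add hL0, Real.rpow_add hL0]
  have hPK : Lr ^ (k₂ + k₃ + k₁ + k₁) ≤ β ^ ((1 : ℝ) / 96) := by
    calc Lr ^ (k₂ + k₃ + k₁ + k₁) ≤ Lr ^ K := Real.rpow_le_rpow_of_exponent_le hL (by linarith)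
      _ ≤ (β ^ a) ^ K := Real.rpow_le_rpow hL0.le hLa hK0
      _ = β ^ (a * K) := (Real.rpow_mul hβ0.le a K).symm
      _ ≤ β ^ ((1 : ℝ) / 96) := Real.rpow_le_rpow_of_exponent_le hβ haK
  have h96 : β ^ ((1 : ℝ) / 96) * β ^ (-(1 : ℝ) / 48) = β ^ (-(1 : ℝ) / 96) := by
    rw [← Real.rpow_add hβ0]; norm_num
  have hbig' : 4 * M * C₂ * C₃ * β ^ (-(1 : ℝ) / 96) ≤ c ^ 2 := by
    have h1 := mul_le_mul_of_nonneg_right hbig (Real.rpow_nonneg hβ0.le (-(1 : ℝ) / 96))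
    have h2 : c ^ 2 * β ^ ((1 : ℝ) / 96) * β ^ (-(1 : ℝ) / 96) = c ^ 2 := by
      rw [mul_assoc, ← Real.rpow_add hβ0]; norm_num
    linarith
  -- the chain
  have hD0 : 0 ≤ 4 * M * C₂ * C₃ := by positivity
  have hbb0 : 0 ≤ b * b := by positivity
  have hll0 : 0 ≤ ℓ * ℓ := by positivity
  calc M * β ^ (-(47 : ℝ) / 48) * (C₂ * Lr ^ k₂ * β ^ (-(1 : ℝ) / 2)) * (4 * κ)
      = 4 * M * C₂ * C₃ * (Lr ^ k₂ * Lr ^ k₃) * (β ^ (-(47 : ℝ) / 48) * β ^ (-(1 : ℝ) / 2) * β ^ ((1 : ℝ) / 8)) := by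
        rw [hκ]; ring
    _ = 4 * M * C₂ * C₃ * (Lr ^ k₂ * Lr ^ k₃ * Lr ^ k₁ * Lr ^ k₁) * (ℓ * ℓ) * (b * b) * β ^ (-(1 : ℝ) / 48) := by
        rw [hβsplit]
        have e : 4 * M * C₂ * C₃ * (Lr ^ k₂ * Lr ^ k₃ * Lr ^ k₁ * Lr ^ k₁) * (ℓ * ℓ) * (b * b) * β ^ (-(1 : ℝ) / 48)
            = 4 * M * C₂ * C₃ * (Lr ^ k₂ * Lr ^ k₃) * (b * b * β ^ (-(1 : ℝ) / 48)) * (Lr ^ k₁ * ℓ) ^ 2 := by ring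
        rw [e, hLk₁]; ring
    _ ≤ 4 * M * C₂ * C₃ * β ^ ((1 : ℝ) / 96) * (ℓ * ℓ) * (b * b) * β ^ (-(1 : ℝ) / 48) := by
        rw [hP]
        have := hPK
        gcongr
    _ = (4 * M * C₂ * C₃ * β ^ (-(1 : ℝ) / 96)) * (ℓ * ℓ) * (b * b) := by
        rw [← h96]; ring
    _ ≤ c ^ 2 * (ℓ * ℓ) * (b * b) := by gcongr
    _ = (c * ℓ * b) ^ 2 := by ring


/-! ## §2 The door -/

/-- ★ **`UncertaintyDoor`** (item stmt-QuantumFields-23356): `CoherentToronFloor → MeanLoopCeilingWeak → TransportKineticCeiling →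
RobertsonInequality →` the ∃-window Fano floor with `(a, q) = (min(a₁,a₂,a₃,1/4,1/(96(K+1))), 47/48)`, `K = max(2k₁+k₂+k₃, 0)`.
[cite: ReedSimonIV1978, Thm. XIII.1] -/
theorem uncertaintyDoor_proof : Summit.QuantumFields.YangMills.Theses.TransportFieldFano.UncertaintyDoor := by
  intro h1 h2 h3 hR
  obtain ⟨a₁, c, k₁, ha₁, hc, b₁, l₁, H1⟩ := h1
  obtain ⟨a₂, C₂, k₂, ha₂, b₂, l₂, H2⟩ := h2
  obtain ⟨a₃, C₃, k₃, ha₃, b₃, l₃, H3⟩ := h3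
  set K : ℝ := max (2 * k₁ + k₂ + k₃) 0 with hK_def
  have hK0 : 0 ≤ K := le_max_right _ _
  have hKle : 2 * k₁ + k₂ + k₃ ≤ K := le_max_left _ _
  set a : ℝ := min (min a₁ a₂) (min a₃ (min (1 / 4) (1 / (96 * (K + 1))))) with ha_def
  have hapos : 0 < a := lt_min (lt_min ha₁ ha₂) (lt_min ha₃ (lt_min (by norm_num) (by positivity)))
  have haa₁ : a ≤ a₁ := (min_le_left _ _).trans (min_le_left _ _)
  have haa₂ : a ≤ a₂ := (min_le_left _ _).trans (min_le_right _ _)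
  have haa₃ : a ≤ a₃ := (min_le_right _ _).trans (min_le_left _ _)
  have ha4 : a ≤ 1 / 4 := (min_le_right _ _).trans ((min_le_right _ _).trans (min_le_left _ _))
  have haK' : a ≤ 1 / (96 * (K + 1)) := (min_le_right _ _).trans ((min_le_right _ _).trans (min_le_right _ _))
  have haK : a * K ≤ 1 / 96 := by
    have hK1 : 0 < K + 1 := by linarith
    calc a * K ≤ 1 / (96 * (K + 1)) * K := mul_le_mul_of_nonneg_right haK' hK0
      _ = K / (K + 1) / 96 := by field_simp
      _ ≤ 1 / 96 := by
        have : K / (K + 1) ≤ 1 := (div_le_one hK1).2 (by linarith)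
        linarith
  refine ⟨a, 47 / 48, hapos, by linarith, by norm_num, by norm_num, by linarith, ?_⟩
  intro M
  -- non-negative constants and the threshold in `β`
  set M' : ℝ := max M 0 with hM'_def
  set C₂' : ℝ := max C₂ 0 with hC₂'_def
  set C₃' : ℝ := max C₃ 0 with hC₃'_def
  have hM'0 : 0 ≤ M' := le_max_right _ _
  have hC₂'0 : 0 ≤ C₂' := le_max_right _ _
  have hC₃'0 : 0 ≤ C₃' := le_max_right _ _
  have hev : ∀ᶠ β : ℝ in atTop, 4 * M' * C₂' * C₃' ≤ c ^ 2 * β ^ ((1 : ℝ) / 96) :=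
    ((tendsto_rpow_atTop (by norm_num : (0 : ℝ) < 1 / 96)).const_mul_atTop (pow_pos hc 2)).eventually_ge_atTop _
  obtain ⟨β₄, hβ₄⟩ := Filter.eventually_atTop.mp hev
  refine ⟨max (max b₁ b₂) (max (max b₃ β₄) 1), max (max l₁ l₂) (max l₃ 2), ?_⟩
  intro β hβ L _ hL hLa Ω hΩ hn heig
  have hb₁ : b₁ ≤ β := le_trans (le_trans (le_max_left _ _) (le_max_left _ _)) hβ
  have hb₂ : b₂ ≤ β := le_trans (le_trans (le_max_right _ _) (le_max_left _ _)) hβ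
  have hb₃ : b₃ ≤ β := le_trans (le_trans (le_trans (le_max_left _ _) (le_max_left _ _)) (le_max_right _ _)) hβ
  have hb₄ : β₄ ≤ β := le_trans (le_trans (le_trans (le_max_right _ _) (le_max_left _ _)) (le_max_right _ _)) hβ
  have hβ1 : (1 : ℝ) ≤ β := le_trans (le_trans (le_max_right _ _) (le_max_right _ _)) hβ
  have hβpos : 0 < β := by linarith
  have hl₁ : l₁ ≤ L := le_trans (le_trans (le_max_left _ _) (le_max_left _ _)) hL
  have hl₂ : l₂ ≤ L := le_trans (le_trans (le_max_right _ _) (le_max_left _ _)) hL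
  have hl₃ : l₃ ≤ L := le_trans (le_trans (le_max_left _ _) (le_max_right _ _)) hL
  have hL2 : 2 ≤ L := le_trans (le_trans (le_max_right _ _) (le_max_right _ _)) hL
  have hL1 : (1 : ℝ) ≤ L := by exact_mod_cast (le_trans one_le_two hL2)
  have hLa₁ : (L : ℝ) ≤ β ^ a₁ := hLa.trans (Real.rpow_le_rpow_of_exponent_le hβ1 haa₁)
  have hLa₂ : (L : ℝ) ≤ β ^ a₂ := hLa.trans (Real.rpow_le_rpow_of_exponent_le hβ1 haa₂)
  have hLa₃ : (L : ℝ) ≤ β ^ a₃ := hLa.trans (Real.rpow_le_rpow_of_exponent_le hβ1 haa₃)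
  -- the four analytic inputs, `let`s expanded
  have H1' := H1 β hb₁ L hl₁ hLa₁ Ω hΩ hn heig
  have H2' := H2 β hb₂ L hl₂ hLa₂ Ω hΩ hn heig
  have H3' := H3 β hb₃ L hl₃ hLa₃ Ω hΩ hn heig
  have hR' := hR β hβpos L hL2 Ω hΩ hn heig
  dsimp only at H1' H2' H3' hR' ⊢
  -- monotone replacements of the constants
  have H2'' := H2'.trans (mul_le_mul_of_nonneg_right (mul_le_mul_of_nonneg_right (le_max_left C₂ 0)
    (Real.rpow_nonneg (Nat.cast_nonneg L) k₂)) (Real.rpow_nonneg hβpos.le _))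
  have H3'' := H3'.trans (mul_le_mul_of_nonneg_right (mul_le_mul_of_nonneg_right (le_max_left C₃ 0)
    (Real.rpow_nonneg (Nat.cast_nonneg L) k₃)) (Real.rpow_nonneg hβpos.le _))
  have hm0 : 0 ≤ l2 (fun U => flowLift 0 (fun u : GaugeConfig 3 1 SU2 =>
      4 - ((su2Rep (u ((0 : Site 3 1), (0 : Fin 3)))).trace.re) ^ 2) U * Ω U) Ω := by
    unfold l2
    refine integral_nonneg fun U => ?_
    have hF0 : 0 ≤ flowLift 0 (fun u : GaugeConfig 3 1 SU2 => 4 - ((su2Rep (u ((0 : Site 3 1), (0 : Fin 3)))).trace.re) ^ 2) U := by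
      rw [flowLift_eq]
      refine div_nonneg (Finset.sum_nonneg fun x _ => ?_) (Nat.cast_nonneg _)
      have h1 := re_trace_le_two ((polyakovSite x (Literature.MathematicalPhysics.QuantumFieldTheory.wilsonFlow 0 U))
        ((0 : Site 3 1), (0 : Fin 3)))
      have h2 := neg_two_le_re_trace ((polyakovSite x (Literature.MathematicalPhysics.QuantumFieldTheory.wilsonFlow 0 U))
        ((0 : Site 3 1), (0 : Fin 3)))
      rw [Literature.MathematicalPhysics.QuantumLattice.fundamentalRep_apply]
      nlinarith
    have : flowLift 0 (fun u : GaugeConfig 3 1 SU2 => 4 - ((su2Rep (u ((0 : Site 3 1), (0 : Fin 3)))).trace.re) ^ 2) U * Ω U * Ω U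
        = flowLift 0 (fun u : GaugeConfig 3 1 SU2 => 4 - ((su2Rep (u ((0 : Site 3 1), (0 : Fin 3)))).trace.re) ^ 2) U * Ω U ^ 2 := by
      ring
    rw [this]
    exact mul_nonneg hF0 (sq_nonneg _)
  have harith := uncertainty_arith (M := M') hc hβ1 hL1 hLa haK hKle hK0 (l2_self_nonneg _) hC₂'0 hC₃'0 hM'0
    H1' H2'' H3'' hR' (hβ₄ β hb₄)
  refine ⟨le_trans ?_ harith.1, harith.2⟩
  exact mul_le_mul_of_nonneg_right (mul_le_mul_of_nonneg_right (le_max_left M 0) (Real.rpow_nonneg hβpos.le _)) hm0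

end Summit.QuantumFields.YangMills.Theorems.TransportFieldFano

end
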